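import Literature.MathematicalPhysics.StatisticalMechanics.LennardJonesThermodynamicLimitProofs
import Summits.AtomisticToContinuum.Crystallization.Theorems.BrittleRungDescentLadderGroundStatesBinding
import Summits.AtomisticToContinuum.Crystallization.Theorems.OneCentreSteepnessLadderZeroDensityOfDefectsBookkeeping

/-!
# Route `OneCentreSteepnessLadder`, item `DominationEnergyLimit`: subadditivity and Fekete for `V_q`

Helper file for item stmt-AtomisticToContinuum-12887 (`DominationEnergyLimit`).  For the normalised
Mie `(2q, q)` potential `V_q = miePotential q` (`q ≠ 0`):

* `groundStateEnergy_miePotential_le` (`E(N) ≤ 𝓔_N(x)` for distinct points, since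
  `V_q ≥ −1/(2q)`);
* `subadditive_groundStateEnergy_miePotential` — `N ↦ E(N)` is subadditive when ground states
  exist for every `N` (a HYPOTHESIS here: the route item carries it): for `K, M ≥ 1` this is the
  strict binding inequality `E(K+M) < E(K) + E(M)` of Blanc–Lewin 2015, §1.2 (6), in the tree as
  the generic `LadderGroundStates.groundStateEnergy_add_lt` (`V 0 = 0`, `V` bounded below,
  `V < 0` beyond `1`); `E(0) = 0`;
* `exists_tendsto_div_of_groundStates` — with a linear lower bound `E(N) ≥ −C N`, Fekete's lemma
  (Mathlib `Subadditive.tendsto_lim`) gives `E(N)/N → e_∞ = inf_{N ≥ 1} E(N)/N`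
  (Blanc–Lewin 2015, §1.3 (8)).

All `[folklore]`; nothing here closes an item.
-/

noncomputable section

namespace Summit.AtomisticToContinuum.Crystallization.Theorems.DominationEnergyLimit

open Literature.MathematicalPhysics.StatisticalMechanics
open Summit.AtomisticToContinuum.Crystallization.Theorems.OneCentreSteepnessLadderZeroDensity
  (miePotential_zero)
open scoped BigOperators
open Filter Topology

/-- `E(N) ≤ 𝓔_N(x)` for `V_q` (`q ≠ 0`) and every configuration of distinct points (the infimum
is a genuine one since `V_q ≥ −1/(2q)`). [folklore] -/
theorem groundStateEnergy_miePotential_le {q : ℕ} (hq : q ≠ 0) {d N : ℕ}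
    {x : Fin N → EuclideanSpace ℝ (Fin d)} (hx : Function.Injective x) :
    groundStateEnergy (miePotential q) d N ≤ interactionEnergy (miePotential q) x :=
  groundStateEnergy_le_of_le (miePotential q) (neg_one_div_le_miePotential hq) hx

/-- **Subadditivity of `N ↦ E(N)` for `V_q`** (`q ≠ 0`, `d ≥ 1`) when ground states exist for
every particle number: for `K, M ≥ 1` the strict binding inequality (two ground states placed far
apart attract, `V_q < 0` beyond `1`); `E(0) = 0`. [folklore] -/
theorem subadditive_groundStateEnergy_miePotential {q : ℕ} (hq : q ≠ 0) {d : ℕ} (hd : 0 < d)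
    (hex : ∀ N : ℕ, ∃ x : Fin N → EuclideanSpace ℝ (Fin d), IsGroundState (miePotential q) x) :
    Subadditive fun N => groundStateEnergy (miePotential q) d N := by
  intro m n
  rcases Nat.eq_zero_or_pos m with rfl | hm
  · simp [groundStateEnergy_of_le_one (miePotential q) (zero_le_one : 0 ≤ 1)]
  rcases Nat.eq_zero_or_pos n with rfl | hn
  · simp [groundStateEnergy_of_le_one (miePotential q) (zero_le_one : 0 ≤ 1)]
  obtain ⟨y, hy⟩ := hex m
  obtain ⟨z, hz⟩ := hex n
  exact (LadderGroundStates.groundStateEnergy_add_lt hd (miePotential_zero hq)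
    (neg_one_div_le_miePotential hq) (fun _ hs => miePotential_neg hq hs) hm hn hy hz).le

/-- **Fekete for `V_q`**: if ground states exist for every `N` (`d ≥ 1`, `q ≠ 0`) and
`E(N) ≥ −C·N` for all `N ≥ 1`, then `E(N)/N` converges to some `e_∞` with `e_∞ ≤ E(N)/N` for
every `N ≥ 1` (Blanc–Lewin 2015, §1.3 (8): subadditivity + Fekete's lemma,
Mathlib `Subadditive.tendsto_lim` / `Subadditive.lim_le_div`). [folklore] -/
theorem exists_tendsto_div_of_groundStates {q : ℕ} (hq : q ≠ 0) {d : ℕ} (hd : 0 < d)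
    (hex : ∀ N : ℕ, ∃ x : Fin N → EuclideanSpace ℝ (Fin d), IsGroundState (miePotential q) x)
    {C : ℝ} (hC : ∀ N : ℕ, 0 < N → -(C * (N : ℝ)) ≤ groundStateEnergy (miePotential q) d N) :
    ∃ e : ℝ, Tendsto (fun N : ℕ => groundStateEnergy (miePotential q) d N / N) atTop (𝓝 e) ∧
      ∀ N : ℕ, 0 < N → e ≤ groundStateEnergy (miePotential q) d N / N := by
  have hsub : Subadditive fun N => groundStateEnergy (miePotential q) d N :=
    subadditive_groundStateEnergy_miePotential hq hd hex
  have hbdd : BddBelow (Set.range fun n : ℕ => groundStateEnergy (miePotential q) d n / n) := by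
    refine ⟨min (-C) 0, ?_⟩
    rintro _ ⟨n, rfl⟩
    rcases Nat.eq_zero_or_pos n with rfl | hn
    · simp only [Nat.cast_zero, div_zero]
      exact min_le_right _ _
    · have hn' : (0 : ℝ) < n := by exact_mod_cast hn
      refine (min_le_left _ _).trans ?_
      rw [le_div_iff₀ hn', neg_mul]
      exact hC n hn
  exact ⟨hsub.lim, hsub.tendsto_lim hbdd, fun N hN => hsub.lim_le_div hbdd hN.ne'⟩

end Summit.AtomisticToContinuum.Crystallization.Theorems.DominationEnergyLimit

end
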